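import Summits.QuantumFields.QCD.Theorems.PauliWegnerSeaFMClosureUnquenchedSideWitnessC1Aux3

/-!
# Side witness, part 6: corner coordinates on the odd torus

Crux `FMClosureUnquenched` (stmt-QuantumFields-11512), line `von-mises-circles`, registered sub-goal
`c1_sideWitness : SideWitness`.

Coordinates for the flows on the admissible sides: the offset `OFF c y i = val (y i - c i) ∈ {0,…,2S}`
of a site `y` of the torus of side `2S+1` from a corner `c`, its behaviour under the unit steps
`±e_μ` (no wrap-around inside the ranges used by the flows), and the description of the even box
`ebox S x r` and the odd ball `ball S x r` of the crux as corner boxes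
`{y | ∀ i, OFF c y i < n}` (`mem_ebox_iff`, `mem_ball_iff`; = registered `c1_sideWitness_aux6`).
-/

namespace Summit.QuantumFields.QCD.Theorems.VonMisesCirclesC1

open Matrix Literature.MathematicalPhysics.QuantumLattice Literature.Probability.LatticeModels
open Summit.QuantumFields.QCD.Theorems.VonMisesCircles Literature.MathematicalPhysics.QuantumFieldTheory

set_option quotPrecheck false in
set_option hygiene false in
/-- The unit step `±e_μ` of label `ℓ = (μ, b)` on the torus of side `2S+1`. -/
local notation "STEP" ℓ:arg =>
  (if Prod.snd ℓ then -(Pi.single (Prod.fst ℓ) 1 : TorusSite 4 (2 * S + 1)) else Pi.single (Prod.fst ℓ) 1)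

set_option quotPrecheck false in
set_option hygiene false in
/-- Offset coordinate `i` of the site `y` from the corner `c`, in `{0, …, 2S}`. -/
local notation "OFF" c:arg y:arg i:arg => (ZMod.val ((y : TorusSite 4 (2 * S + 1)) i - (c : TorusSite 4 (2 * S + 1)) i))

/-! ## Offsets under unit steps -/

/-- A step in direction `μ` does not change the other offsets. -/
theorem off_add_step_of_ne {S : ℕ} (c y : TorusSite 4 (2 * S + 1)) (ℓ : Fin 4 × Bool) {k : Fin 4}
    (hk : k ≠ ℓ.1) : OFF c (y + STEP ℓ) k = OFF c y k := by
  congr 1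
  obtain ⟨μ, b⟩ := ℓ
  cases b <;> simp [hk]

/-- A forward step raises the offset by one (no wrap-around). -/
theorem off_add_step_fwd {S : ℕ} (c y : TorusSite 4 (2 * S + 1)) (μ : Fin 4)
    (h : OFF c y μ + 1 < 2 * S + 1) :
    OFF c (y + STEP ((μ, false) : Fin 4 × Bool)) μ = OFF c y μ + 1 := by
  haveI : Fact (1 < 2 * S + 1) := ⟨by omega⟩
  have h1 : ((y + STEP ((μ, false) : Fin 4 × Bool) : TorusSite 4 (2 * S + 1)) μ) - c μ = (y μ - c μ) + 1 := by
    simp; ring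
  rw [h1, ZMod.val_add_of_lt, ZMod.val_one]
  rwa [ZMod.val_one]

/-- A backward step lowers the offset by one (no wrap-around). -/
theorem off_add_step_bwd {S : ℕ} (c y : TorusSite 4 (2 * S + 1)) (μ : Fin 4) (h : 0 < OFF c y μ) :
    OFF c (y + STEP ((μ, true) : Fin 4 × Bool)) μ = OFF c y μ - 1 := by
  have hlt := ZMod.val_lt (y μ - c μ)
  haveI : Fact (1 < 2 * S + 1) := ⟨by omega⟩
  have h1 : ((y + STEP ((μ, true) : Fin 4 × Bool) : TorusSite 4 (2 * S + 1)) μ) - c μ = (y μ - c μ) - 1 := by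
    simp; ring
  have hle : (1 : ZMod (2 * S + 1)).val ≤ (y μ - c μ).val := by rw [ZMod.val_one]; exact h
  rw [h1, ZMod.val_sub hle, ZMod.val_one]

/-- Offsets are `< 2S+1`. -/
theorem off_lt {S : ℕ} (c y : TorusSite 4 (2 * S + 1)) (i : Fin 4) : OFF c y i < 2 * S + 1 :=
  ZMod.val_lt _

/-! ## Corner description of the even box and the odd ball -/

/-- The value of a small nonnegative integer in `ℤ/(2S+1)`. -/
theorem val_intCast_of_nonneg_lt {S : ℕ} (k : ℤ) (h0 : 0 ≤ k) (h1 : k < 2 * S + 1) :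
    (((k : ZMod (2 * S + 1))).val : ℤ) = k := by
  rw [ZMod.val_intCast]
  exact Int.emod_eq_of_lt h0 (by exact_mod_cast h1)

/-- Offsets of a translated integer point with coordinates in a window of length `< 2S+1`. -/
theorem off_translate {S : ℕ} (x : TorusSite 4 (2 * S + 1)) (L : ℤ) (w : Fin 4 → ℤ) (i : Fin 4)
    (h0 : L ≤ w i) (h1 : w i - L < 2 * S + 1) :
    (OFF (x + Torus.proj (2 * S + 1) (fun _ => L)) (x + Torus.proj (2 * S + 1) w) i : ℤ) = w i - L := by
  have h : ((x + Torus.proj (2 * S + 1) w : TorusSite 4 (2 * S + 1)) i) -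
      ((x + Torus.proj (2 * S + 1) (fun _ => L) : TorusSite 4 (2 * S + 1)) i) =
      (((w i - L : ℤ)) : ZMod (2 * S + 1)) := by
    simp [Torus.proj_apply]
  rw [h]
  exact val_intCast_of_nonneg_lt _ (by omega) h1

/-- Reconstruction of a site from its offsets. -/
theorem eq_corner_add_proj_off {S : ℕ} (c y : TorusSite 4 (2 * S + 1)) :
    y = c + Torus.proj (2 * S + 1) (fun i => ((OFF c y i : ℕ) : ℤ)) := by
  funext i
  simp [Torus.proj_apply]

/-- **The even box as a corner box**: `y ∈ ebox S x r` iff all offsets from the corner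
`x + (-r-1, …, -r-1)` are `< 2r+2`. -/
theorem mem_ebox_iff {S : ℕ} (x : TorusSite 4 (2 * S + 1)) {r : ℕ} (hr : r + 1 ≤ S)
    (y : TorusSite 4 (2 * S + 1)) :
    y ∈ ebox S x r ↔ ∀ i, OFF (x + Torus.proj (2 * S + 1) (fun _ => -(r : ℤ) - 1)) y i < 2 * r + 2 := by
  constructor
  · intro hy i
    simp only [ebox, Finset.mem_image, Fintype.mem_piFinset, Finset.mem_Icc] at hy
    obtain ⟨w, hw, rfl⟩ := hy
    have hw1 := (hw i).1
    have hw2 := (hw i).2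
    have h := off_translate x (-(r : ℤ) - 1) w i (by omega) (by omega)
    omega
  · intro h
    simp only [ebox, Finset.mem_image, Fintype.mem_piFinset, Finset.mem_Icc]
    refine ⟨fun i => ((OFF (x + Torus.proj (2 * S + 1) (fun _ => -(r : ℤ) - 1)) y i : ℕ) : ℤ) - r - 1,
      fun i => ?_, ?_⟩
    · have := h i
      constructor
      · simp only; omega
      · simp only; omega
    · funext i
      simp only [Pi.add_apply, Torus.proj_apply]
      push_cast
      rw [ZMod.natCast_zmod_val]
      ring

/-- **The odd ball as a corner box**: `y ∈ ball S x r` iff all offsets from the corner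
`x + (-r, …, -r)` are `< 2r+1`. -/
theorem mem_ball_iff {S : ℕ} (x : TorusSite 4 (2 * S + 1)) {r : ℕ} (hr : r + 1 ≤ S)
    (y : TorusSite 4 (2 * S + 1)) :
    y ∈ ball S x r ↔ ∀ i, OFF (x + Torus.proj (2 * S + 1) (fun _ => -(r : ℤ))) y i < 2 * r + 1 := by
  constructor
  · intro hy i
    simp only [ball, box, Finset.mem_image, Fintype.mem_piFinset, Finset.mem_Icc] at hy
    obtain ⟨w, hw, rfl⟩ := hy
    have hw1 := (hw i).1
    have hw2 := (hw i).2
    have h := off_translate x (-(r : ℤ)) w i (by omega) (by omega)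
    omega
  · intro h
    simp only [ball, box, Finset.mem_image, Fintype.mem_piFinset, Finset.mem_Icc]
    refine ⟨fun i => ((OFF (x + Torus.proj (2 * S + 1) (fun _ => -(r : ℤ))) y i : ℕ) : ℤ) - r,
      fun i => ?_, ?_⟩
    · have := h i
      constructor
      · simp only; omega
      · simp only; omega
    · funext i
      simp only [Pi.add_apply, Torus.proj_apply]
      push_cast
      rw [ZMod.natCast_zmod_val]
      ring

/-- **Registered helper `c1_sideWitness_aux6` of crux stmt-QuantumFields-11512** (line `von-mises-circles`,
sub-goal `c1_sideWitness`): the even box and the odd ball of the crux as corner boxes. -/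
theorem c1_sideWitness_aux6 : ∀ (S : ℕ) (x : TorusSite 4 (2 * S + 1)) (r : ℕ), r + 1 ≤ S → ∀ (y : TorusSite 4 (2 * S + 1)), (y ∈ ebox S x r ↔ ∀ i : Fin 4, (ZMod.val ((y : TorusSite 4 (2 * S + 1)) i - ((x + Torus.proj (2 * S + 1) (fun _ => -(r : ℤ) - 1)) : TorusSite 4 (2 * S + 1)) i)) < 2 * r + 2) ∧ (y ∈ ball S x r ↔ ∀ i : Fin 4, (ZMod.val ((y : TorusSite 4 (2 * S + 1)) i - ((x + Torus.proj (2 * S + 1) (fun _ => -(r : ℤ))) : TorusSite 4 (2 * S + 1)) i)) < 2 * r + 1) :=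
  fun _ x _ hr y => ⟨mem_ebox_iff x hr y, mem_ball_iff x hr y⟩

end Summit.QuantumFields.QCD.Theorems.VonMisesCirclesC1
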